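import Summits.NavierStokesRegularity.TurbBounds.CouetteForm
import Summits.NavierStokesRegularity.TurbBounds.Certs.C200.CutoffFree
import HarnessLib

/-!
# Row R-C200 (= gate G1: plane Couette, Re = 200, label '2.5-D spectral constraint') from TWO named hypotheses: the cited reduction `Couette25Reduction`
# and the per-wavenumber polynomial positivity `PolyPositivityC200` of the 22 certified modes — cutoff, cover, density and profile arithmetic kernel-checked
(cell `pub-turb` / `turb-bounds`, shear lane; v2 staging, written by pub-turb-shear gen 7, 2026-08-22. CERTIFIED.md row R-C200, container
`G1-couette2p5d-Re200-P12-N16-j110799` (rbcert.json sha256 fdbcb3d46cfd637f…): `C_ε ≤ B/Re`, `B ≤ 2.696319252`, `C_ε ≤ 0.01348159626`; scalar lines in the tree as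
`Certs.C200.Scalars`, blocks `B001…B022`, evaluator `EvalBlock1…22`, `CutoffFree`, `TailSlack`; per-mode compositions `Certs/C200/ModeForm1…22` staged (Ca).)

HONEST FRAMING: rigorous bounds for the stated PDE and boundary conditions; no claim about physical turbulence beyond the bound.
WHAT IS KERNEL-CHECKED HERE: with `g := Σ_{p ≤ 12} ĝ_p P_p` the row's literal profile (`gC200`; `ĝ = Certs.C200.Scalars.ghat`): the wall condition `∫g = Re·a`
(`ĝ₀ = (Re/2)(1+c)`, `a = 1 + c`), the sup bound `|g| ≤ ‖ĝ‖₁ = T`, the value of the bound functional `couetteBound a Re g = Scalars.B` (Parseval), and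
`couettePositivity_of_polyPositivity`: IF the two-field forms of the 22 certified wavenumbers are `≥ 0` on two-sided POLYNOMIAL pairs (`PolyPositivityC200`) THEN the
streamwise-invariant spectral constraint holds for EVERY integer `k ≥ 1` on the two-sided `C² × C¹` class (cert's `RBDensity.rbForm_nonneg_of_poly2` + the landed cutoff
line `Certs.C200.Scalars.cutoff` through `CouetteForm.couettePositivity_of_cover`). CONSEQUENCES: `dissipation_bound` — for every `D` obeying `Couette25Reduction 200 D`
(the cited reduction RESTRICTED TO STREAMWISE-INVARIANT SOLUTIONS, docstring in `CouetteForm`): `PolyPositivityC200 → D ≤ B`, `ceps_bound`: `C_ε = D/200 ≤ Scalars.Ceps ≤ 0.01348159626`.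
THE SECOND HYPOTHESIS is what the staged two-field chain discharges (`Certs.C200.ModeForm.M<k>.modeForm_nonneg` + `ShearBridgeNormsTF` + cert's `CouplingSplit`; bridge file
not yet written). NOT CLAIMED: anything about three-dimensional solutions; any formalisation of the Navier–Stokes reduction.
-/

set_option linter.style.longLine false

noncomputable section

namespace Summit.NavierStokesRegularity.TurbBounds.Results.C200

open Polynomial intervalIntegral MeasureTheory Set Finset
open Literature.Analysis.SpecialFunctions (legendre eval_one_legendre natDegree_legendre abs_eval_legendre_le_one legendre_zero)
open Summit.NavierStokesRegularity.TurbBounds.TailPolyGenW (rbForm)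
open Summit.NavierStokesRegularity.TurbBounds.TailTwoSided (TwoSidedX)
open Summit.NavierStokesRegularity.TurbBounds.RBDensity (rbForm_nonneg_of_poly2)
open Summit.NavierStokesRegularity.TurbBounds.CouetteForm
open Summit.NavierStokesRegularity.TurbBounds.LegendreCoeffs
open Summit.NavierStokesRegularity.TurbBounds.LadderTail (w)
open Summit.NavierStokesRegularity.TurbBounds.Certs.C200

/-! ## 1. The row's profile and its scalar facts -/

/-- The row's Legendre data `ĝ_p` of `g = (Re/2)(aU′ + ζ′)` as real numbers (`Certs.C200.Scalars.ghat`, `P = 12`; `0` beyond). -/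
def ghatC200 (p : ℕ) : ℝ := ((Scalars.ghat.getD p 0 : ℚ) : ℝ)

/-- The profile `g = Σ_{p ≤ 12} ĝ_p P_p(x)` of the certified background pair (CERT-SHEAR §3). -/
def gC200 : ℝ[X] := ∑ p ∈ range (12 + 1), C (ghatC200 p) * legendre p

/-- **Sup bound** `|g(x)| ≤ ‖ĝ‖₁ = T` on `[−1, 1]` (`|P_p| ≤ 1`, `Scalars.l1_ghat`). -/
theorem gC200_abs_le : ∀ x ∈ Icc (-1 : ℝ) 1, |gC200.eval x| ≤ (Scalars.T : ℝ) := by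
  intro x hx
  have hx1 : |x| ≤ 1 := abs_le.mpr ⟨hx.1, hx.2⟩
  unfold gC200
  rw [eval_finsetSum]
  calc |∑ p ∈ range (12 + 1), (C (ghatC200 p) * legendre p).eval x|
      ≤ ∑ p ∈ range (12 + 1), |(C (ghatC200 p) * legendre p).eval x| := Finset.abs_sum_le_sum_abs _ _
    _ ≤ ∑ p ∈ range (12 + 1), |ghatC200 p| := by
        refine Finset.sum_le_sum fun p _ => ?_
        rw [eval_mul, eval_C, abs_mul]
        calc |ghatC200 p| * |(legendre p).eval x| ≤ |ghatC200 p| * 1 :=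
              mul_le_mul_of_nonneg_left (abs_eval_legendre_le_one p hx1) (abs_nonneg _)
          _ = |ghatC200 p| := mul_one _
    _ = (Scalars.T : ℝ) := by
        simp only [Finset.sum_range_succ, Finset.sum_range_zero, ghatC200]
        norm_num [Scalars.ghat, Scalars.T]

/-- **Wall condition** `ζ(±½) = 0`: `∫_{−1}^{1} g = 2ĝ₀ = Re·(1 + c) = Re·a` (`Scalars.ghat_zero`, `Scalars.c_eq`). -/
theorem integral_gC200 : (∫ x in (-1 : ℝ)..1, gC200.eval x) = (Scalars.Re : ℝ) * (Scalars.a : ℝ) := by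
  unfold gC200
  rw [integral_legendreProfile 12 ghatC200]
  simp only [ghatC200]
  norm_num [Scalars.ghat, Scalars.Re, Scalars.a]

/-- **The bound functional at the certified pair is the certified `B`**: `(1/(a−1))⟨aU′² + U′ζ′ + ζ′²/4⟩ = (1+c)/c + (1/(cRe²))Σ_{p≥1} ĝ_p²/(2p+1) = Scalars.B`. -/
theorem couetteBound_gC200 : couetteBound (Scalars.a : ℝ) (Scalars.Re : ℝ) (fun x => gC200.eval x) = (Scalars.B : ℝ) := by
  have hRe : (Scalars.Re : ℝ) ≠ 0 := by norm_num [Scalars.Re]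
  rw [couetteBound_eq_of_wall hRe gC200.continuous integral_gC200]
  -- (2g/Re − a)² = (2/Re)²·(g − ĝ₀)² since a = 2ĝ₀/Re
  have ha : (Scalars.a : ℝ) = 2 * ghatC200 0 / (Scalars.Re : ℝ) := by
    simp only [ghatC200]; norm_num [Scalars.ghat, Scalars.Re, Scalars.a]
  have hsq : (∫ x in (-1 : ℝ)..1, (2 * gC200.eval x / (Scalars.Re : ℝ) - (Scalars.a : ℝ)) ^ 2)
      = (2 / (Scalars.Re : ℝ)) ^ 2 * ∫ x in (-1 : ℝ)..1, (gC200.eval x - ghatC200 0) ^ 2 := by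
    rw [← intervalIntegral.integral_const_mul]
    refine intervalIntegral.integral_congr fun x _ => ?_
    rw [ha]; field_simp
  have hpar := integral_sq_sub_mean_legendreProfile 12 ghatC200
  unfold gC200 at hsq ⊢
  rw [hsq, hpar]
  simp only [Finset.sum_range_succ, Finset.sum_range_zero, ghatC200, w]
  norm_num [Scalars.ghat, Scalars.Re, Scalars.a, Scalars.B]

/-! ## 2. The second named hypothesis and the cover -/

/-- **Named hypothesis `PolyPositivityC200`** (to be DISCHARGED by the staged two-field chain: `Certs.C200.ModeForm.M<k>.modeForm_nonneg`, `CouetteModeAssembly`,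
`ShearBridgeNormsTF`, cert's `CouplingSplit`): for each certified spanwise wavenumber `k = 1, …, m_cert = 22` and every pair of real polynomials `(W, Θ)` with
`W(±1) = W′(±1) = 0`, `Θ(±1) = 0`, the streamwise-invariant spectral-constraint form `rbForm c c g k²` with `c = Scalars.c = a − 1` is `≥ 0`. -/
def PolyPositivityC200 : Prop :=
  ∀ k : ℕ, 1 ≤ k → k ≤ Scalars.mCert → ∀ Wp Θp : ℝ[X],
    Wp.eval (-1) = 0 → (derivative Wp).eval (-1) = 0 → Wp.eval 1 = 0 → (derivative Wp).eval 1 = 0 →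
    Θp.eval (-1) = 0 → Θp.eval 1 = 0 →
    0 ≤ rbForm (Scalars.c : ℝ) (Scalars.c : ℝ) (fun x => gC200.eval x) ((k : ℝ) ^ 2) (fun x => Wp.eval x) (fun x => Θp.eval x)

/-- **From polynomial positivity of the 22 certified wavenumbers to the streamwise-invariant spectral constraint for EVERY `k ≥ 1`** on the two-sided class:
density (`RBDensity.rbForm_nonneg_of_poly2`) + cover by the landed cutoff line `Certs.C200.Scalars.cutoff` (`k ≥ 23` free, lemma R-SC). -/
theorem couettePositivity_of_polyPositivity (h : PolyPositivityC200) : CouettePositivity (Scalars.c : ℝ) (fun x => gC200.eval x) := by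
  have hc : (0 : ℝ) < (Scalars.c : ℝ) := by exact_mod_cast Scalars.c_pos
  have hcut : (Scalars.T : ℝ) ≤ (Scalars.c : ℝ) * ((Scalars.mCert : ℝ) + 1) ^ 2 := by
    have h1 : ((Scalars.T : ℚ) : ℝ) ≤ ((Scalars.c * ((Scalars.mCert : ℚ) + 1) ^ 2 : ℚ) : ℝ) := by exact_mod_cast Scalars.cutoff
    push_cast at h1
    exact h1
  refine couettePositivity_of_cover hc gC200_abs_le hcut fun k hk hle W Θ hWΘ => ?_
  exact rbForm_nonneg_of_poly2 gC200.continuous (fun Wp Θp h0 h1 h2 h3 h4 h5 => h k hk hle Wp Θp h0 h1 h2 h3 h4 h5) hWΘ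

/-! ## 3. The row theorem from the two named hypotheses (parameters as literals: `Re = 200`) -/

/-- **Row R-C200 (G1), mean dissipation of streamwise-invariant solutions.** For every `D` obeying `Couette25Reduction 200 D` and given `PolyPositivityC200`:
`D ≤ B = Scalars.B ≤ 2.696319252`. -/
theorem dissipation_bound (D : ℝ) (hRed : Couette25Reduction (200 : ℝ) D) (hPoly : PolyPositivityC200) : D ≤ (Scalars.B : ℝ) := by
  have hRe : ((Scalars.Re : ℚ) : ℝ) = 200 := by norm_num [Scalars.Re]
  have ha : (1 : ℝ) < (Scalars.a : ℝ) := by norm_num [Scalars.a]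
  have hca : (Scalars.a : ℝ) - 1 = (Scalars.c : ℝ) := by
    have h := Scalars.c_eq
    rw [h]; push_cast; ring
  have hpos : CouettePositivity ((Scalars.a : ℝ) - 1) (fun x => gC200.eval x) := by
    rw [hca]; exact couettePositivity_of_polyPositivity hPoly
  have hwall : (∫ x in (-1 : ℝ)..1, gC200.eval x) = (200 : ℝ) * (Scalars.a : ℝ) := by rw [integral_gC200, hRe]
  have h := hRed (Scalars.a : ℝ) gC200 ha hwall hpos
  rw [← hRe, couetteBound_gC200] at h
  exact h

/-- **Row R-C200, dissipation coefficient**: `Couette25Reduction 200 D → PolyPositivityC200 → C_ε = D/200 ≤ Scalars.Ceps` (`= B/Re`, `Scalars.Ceps_eq`). -/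
theorem ceps_bound (D : ℝ) (hRed : Couette25Reduction (200 : ℝ) D) (hPoly : PolyPositivityC200) : D / 200 ≤ (Scalars.Ceps : ℝ) := by
  have h := dissipation_bound D hRed hPoly
  have hC : (Scalars.Ceps : ℝ) = (Scalars.B : ℝ) / 200 := by
    have h1 := Scalars.Ceps_eq
    rw [h1]; push_cast; norm_num [Scalars.Re]
  rw [hC]
  exact div_le_div_of_nonneg_right h (by norm_num)

/-- The outward decimal of CERTIFIED.md row R-C200: `C_ε ≤ 0.01348159626`. -/
theorem ceps_bound_decimal (D : ℝ) (hRed : Couette25Reduction (200 : ℝ) D) (hPoly : PolyPositivityC200) :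
    D / 200 ≤ (674079813 : ℝ) / 50000000000 := by
  have h := ceps_bound D hRed hPoly
  have hd : ((Scalars.Ceps : ℚ) : ℝ) ≤ (((674079813 : ℚ) / 50000000000 : ℚ) : ℝ) := by exact_mod_cast Scalars.Ceps_decimal
  push_cast at hd
  linarith

/-! ## 4. Vacuity guards -/

/-- The first hypothesis is satisfiable as typed at this row's Reynolds number (laminar dissipation `D = 1`). -/
theorem couette25Reduction_laminar_row : Couette25Reduction (200 : ℝ) 1 :=
  couette25Reduction_laminar (by norm_num)

/-- … and, given `PolyPositivityC200`, NOT provable for every `D`: `D = 3 > B` violates it. -/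
theorem couette25Reduction_nontrivial (hPoly : PolyPositivityC200) : ¬ Couette25Reduction (200 : ℝ) 3 := by
  intro hRed
  have h := dissipation_bound 3 hRed hPoly
  have hB : ((Scalars.B : ℚ) : ℝ) ≤ (((4314110803 : ℚ) / 1600000000 : ℚ) : ℝ) := by exact_mod_cast Scalars.B_decimal
  push_cast at hB
  linarith

end Summit.NavierStokesRegularity.TurbBounds.Results.C200

end
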